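import Summits.NavierStokesRegularity.NavierStokesRegularity.Theorems.QuantisedSymmetryPolyhedralDssProfileExistsCellOfProfile
import Summits.NavierStokesRegularity.NavierStokesRegularity.Theorems.QuantisedSymmetryPolyhedralDssProfileExistsStubClassicalOfOseenMildPast
import Summits.NavierStokesRegularity.NavierStokesRegularity.Theorems.QuantisedSymmetryPolyhedralDssProfileExistsStubPeriodWindow
import Summits.NavierStokesRegularity.NavierStokesRegularity.Theorems.QuantisedSymmetryPolyhedralDssProfileExistsStubSingularOrigin
import Summits.NavierStokesRegularity.NavierStokesRegularity.Theorems.QuantisedSymmetryPolyhedralDssProfileExistsStubNoSmallSlice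
import Summits.NavierStokesRegularity.NavierStokesRegularity.Theorems.QuantisedSymmetryPolyhedralDssProfileExistsStubNotAxisymmetric
import Summits.NavierStokesRegularity.NavierStokesRegularity.Theorems.QuantisedSymmetryPolyhedralDssProfileExistsStubCentreJet2
import Summits.NavierStokesRegularity.NavierStokesRegularity.Theorems.QuantisedSymmetryPolyhedralDssProfileExistsStubVorticityEverySlice
import HarnessLib

/-!
# The portrait of a witness — crux stmt-NavierStokesRegularity-1404 (`QuantisedSymmetry.PolyhedralDssProfileExists`),
  line polyhedral_cell, registered stub N11 (lead c16)

One theorem assembling, for an arbitrary witness `(G, c, u, C₀)` of the crux X⁻ (a `G`-equivariant,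
exactly `c`-DSS, Type-I ancient mild profile in the duality form, not a.e. trivial; irreducible `G`), the
necessary conditions landed by lead c16's two worker waves on the Oseen-gauge representative `V` of `u`
(stub A1, p156260) with its transported self-similarity and equivariance (A2, p155960) and its classical
pressure `p` (p152134):

* `u` is not continuously self-similar (period window N1, Chae–Wolf 2017 Thm 1.3, p159657);
* every slice of `V` exceeds the universal scale-invariant floor `ε₁` somewhere (no small slice N5, p160315)
  and carries vorticity (N9, p160558);
* the 2-jet at the singular point vanishes: `V(t,0) = 0`, `DV(t,0) = 0`, `ΔV(t,0) = 0`, `∇p(t,0) = 0`,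
  `D²p(t,0) = 0` (Schur, N8, p160606);
* `V` is unbounded in every parabolic cylinder at the space–time origin (N3, p159845);
* `V` is not axisymmetric about the `x₃`-axis (KNSS 2009 Thm 5.3, N7, p160737).

No new analysis: this file is bookkeeping over landed theorems, so that the portrait is ONE tree statement
about witnesses of the crux (what the ∃-hunter must produce and what the kill switch #3 may use).
-/

noncomputable section

-- the summit namespace `…NavierStokesRegularity.NavierStokesRegularity…` is the tree convention (D-0017)
set_option linter.dupNamespace false

namespace Summit.NavierStokesRegularity.NavierStokesRegularity.Theorems.PolyhedralDssProfileExists.PolyhedralCell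

open MeasureTheory Set Function Filter Topology
open Literature.Analysis Literature.Analysis.FluidPDE
open scoped InnerProductSpace RealInnerProductSpace Laplacian

/-- **A Type-I bound with a nonpositive constant forces triviality**: `HasTypeIDecay C₀ u` with `C₀ ≤ 0`
gives `u t x = 0` for every `t < 0` and `x` (the bound `‖u t x‖ ≤ C₀/(‖x‖ + √(-t)) ≤ 0`). [folklore] -/
theorem portrait_eq_zero_of_hasTypeIDecay_nonpos
    {u : ℝ → EuclideanSpace ℝ (Fin 3) → EuclideanSpace ℝ (Fin 3)} {C₀ : ℝ}
    (hdec : HasTypeIDecay C₀ u) (hC₀ : C₀ ≤ 0) : ∀ t < 0, ∀ x, u t x = 0 := by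
  intro t ht x
  have hden : 0 < ‖x‖ + Real.sqrt (-t) := by
    have : 0 < Real.sqrt (-t) := Real.sqrt_pos.2 (by linarith)
    positivity
  have h1 : ‖u t x‖ ≤ C₀ / (‖x‖ + Real.sqrt (-t)) := hdec t ht x
  have h2 : C₀ / (‖x‖ + Real.sqrt (-t)) ≤ 0 := div_nonpos_of_nonpos_of_nonneg hC₀ hden.le
  exact norm_le_zero_iff.1 (h1.trans h2)

/-- **No witness is continuously self-similar** (corollary of the period window N1): an ancient mild
solution (duality form, measurable slices) with a Type-I bound which is self-similar for EVERY factor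
(`IsSelfSimilar u`) has all its negative slices a.e. zero — for `C₀ ≤ 0` directly, for `C₀ > 0` because it
is in particular `μ`-DSS for a factor `μ ∈ (1, c₁(C₀))` inside Chae–Wolf's window.
[cite: ChaeWolf2017RemovingDSS, Theorem 1.3] -/
theorem portrait_ae_zero_of_isSelfSimilar
    {u : ℝ → EuclideanSpace ℝ (Fin 3) → EuclideanSpace ℝ (Fin 3)} {C₀ : ℝ}
    (hanc : IsAncientMildSolution 1 u) (hmeas : ∀ t < 0, AEStronglyMeasurable (u t) volume)
    (hdec : HasTypeIDecay C₀ u) (hss : IsSelfSimilar u) : ∀ t < 0, u t =ᵐ[volume] 0 := by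
  rcases le_or_gt C₀ 0 with hC₀ | hC₀
  · intro t ht
    have h : u t = 0 := funext fun x => portrait_eq_zero_of_hasTypeIDecay_nonpos hdec hC₀ t ht x
    rw [h]
  · obtain ⟨c₁, hc₁, hwin⟩ := stub_periodWindow C₀ hC₀
    have hμ1 : 1 < (1 + c₁) / 2 := by linarith
    have hμ2 : (1 + c₁) / 2 < c₁ := by linarith
    have hdssμ : IsDiscretelySelfSimilar ((1 + c₁) / 2) u := hss _ (by linarith)
    exact hwin _ u hμ1 hμ2 hanc hmeas hdssμ hdec

/-- **REGISTERED STUB `stub_witnessPortrait` (N11, lead c16): the portrait of a witness of the crux.**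
There is an absolute `ε₁ > 0` such that every witness `(G, c, u, C₀)` of
`QuantisedSymmetry.PolyhedralDssProfileExists` (irreducible `G`; finiteness and `det = 1` unused) has an
Oseen-gauge representative `V` (`IsTypeIAncientMild C V`, `HasTypeIDecay C₀ V`, `V t =ᵐ u t`), exactly
`c`-DSS and `G`-equivariant, classical on the open past with some pressure `p`, and: `u` is not continuously
self-similar; every slice of `V` exceeds the scale-invariant floor `ε₁` somewhere and carries vorticity; the
2-jet `(V, DV, ΔV, ∇p, D²p)(t, 0)` vanishes; `V` is unbounded in every parabolic cylinder at the origin; `V`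
is not axisymmetric about the `x₃`-axis. Assembly of A1, A2, p152134, N1, N3, N5, N7, N8, N9. [folklore] -/
theorem stub_witnessPortrait :
    ∃ ε₁ : ℝ, 0 < ε₁ ∧
      ∀ (G : Subgroup (EuclideanSpace ℝ (Fin 3) ≃ₗᵢ[ℝ] EuclideanSpace ℝ (Fin 3))) (c : ℝ)
        (u : ℝ → EuclideanSpace ℝ (Fin 3) → EuclideanSpace ℝ (Fin 3)) (C₀ : ℝ),
        (∀ W : Submodule ℝ (EuclideanSpace ℝ (Fin 3)), (∀ g ∈ G, ∀ v ∈ W, g v ∈ W) → W = ⊥ ∨ W = ⊤) →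
        1 < c → IsAncientMildSolution 1 u → (∀ t < 0, AEStronglyMeasurable (u t) volume) →
        IsDiscretelySelfSimilar c u → HasTypeIDecay C₀ u → (∀ g ∈ G, ∀ t x, u t (g x) = g (u t x)) →
        ¬ (∀ t < 0, u t =ᵐ[volume] 0) →
        ∃ (V : ℝ → EuclideanSpace ℝ (Fin 3) → EuclideanSpace ℝ (Fin 3)) (C : ℝ)
          (p : ℝ → EuclideanSpace ℝ (Fin 3) → ℝ),
          IsTypeIAncientMild C V ∧ HasTypeIDecay C₀ V ∧ (∀ t < 0, V t =ᵐ[volume] u t) ∧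
          IsDiscretelySelfSimilar c V ∧ (∀ g ∈ G, ∀ t x, V t (g x) = g (V t x)) ∧
          IsClassicalNSSolutionOn (Set.Iio 0) 1 0 V p ∧
          ¬ IsSelfSimilar u ∧
          (∀ t < 0, ∃ x, ε₁ < Real.sqrt (-t) * ‖V t x‖) ∧
          (∀ t < 0, ∃ x, curl (V t) x ≠ 0) ∧
          (∀ t < 0, V t 0 = 0 ∧ fderiv ℝ (V t) 0 = 0 ∧ (Δ (V t)) 0 = 0 ∧
            gradient (p t) 0 = 0 ∧ fderiv ℝ (gradient (p t)) 0 = 0) ∧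
          (∀ r : ℝ, 0 < r → ∀ M : ℝ, ∃ t ∈ Set.Ioo (-r ^ 2) 0, ∃ x : EuclideanSpace ℝ (Fin 3),
            ‖x‖ < r ∧ M < ‖V t x‖) ∧
          ¬ (∀ t < 0, IsAxisymmetric (V t)) := by
  obtain ⟨ε₁, hε₁, hN5⟩ := stub_noSmallSlice
  refine ⟨ε₁, hε₁, ?_⟩
  intro G c u C₀ hirr hc hanc hmeas hdss hdec hequ hnt
  -- A1: the Oseen-gauge representative; A2: transport of DSS and equivariance; classical pressure
  obtain ⟨V, C, hV, hdecV, hae, hzero⟩ := stub_smoothRepresentative_ae u C₀ hanc hmeas hdec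
  obtain ⟨hdssV, hequV⟩ := stub_transport_ae G c u V C hc hdss hequ hV hae hzero
  obtain ⟨p, hcl⟩ := exists_isClassicalNSSolutionOn_Iio_of_isTypeIAncientMild hV
  -- a point where `V` is nonzero
  obtain ⟨t₀, ht₀, x₀, hx₀⟩ := exists_apply_ne_zero_of_ae_repr hae hnt
  have hne : ∃ t₀ < 0, ∃ x₀, V t₀ x₀ ≠ 0 := ⟨t₀, ht₀, x₀, hx₀⟩
  refine ⟨V, C, p, hV, hdecV, hae, hdssV, hequV, hcl, ?_, ?_, ?_, ?_, ?_, ?_⟩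
  · -- not continuously self-similar (N1)
    intro hss
    exact hnt (portrait_ae_zero_of_isSelfSimilar hanc hmeas hdec hss)
  · -- the per-slice floor (N5)
    intro t ht
    by_contra h
    push Not at h
    have hzeroV := hN5 c C C₀ V hc hV hdssV hdecV t ht h
    exact hx₀ (hzeroV t₀ ht₀ x₀)
  · -- vorticity on every slice (N9)
    exact stub_vorticityEverySlice c C C₀ V hc hV hdssV hdecV hne
  · -- the 2-jet at the singular point (N8)
    exact stub_centreJet2 G hirr V p hcl hequV
  · -- the singular origin (N3)
    exact stub_singularOrigin c V hc hdssV hne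
  · -- not axisymmetric (N7)
    intro hax
    have hax' : ∀ θ : ℝ, ∀ t < 0, (fun x => u t (rotZ θ x)) =ᵐ[volume] fun x => rotZ θ (u t x) := by
      intro θ t ht
      have h1 : (fun x => u t (rotZ θ x)) =ᵐ[volume] fun x => V t (rotZ θ x) :=
        (measurePreserving_rotZ θ).quasiMeasurePreserving.ae_eq (hae t ht).symm
      have h2 : (fun x => rotZ θ (V t x)) =ᵐ[volume] fun x => rotZ θ (u t x) :=
        (hae t ht).fun_comp (rotZ θ)
      refine (h1.trans ?_).trans h2
      exact Eventually.of_forall fun x => hax t ht θ x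
    exact hnt (stub_notAxisymmetric u C₀ hanc hmeas hdec hax')

end Summit.NavierStokesRegularity.NavierStokesRegularity.Theorems.PolyhedralDssProfileExists.PolyhedralCell

end
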